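import Mathlib

/-!
# Increment convexity of the alternating block energy, I: the abstract reduction

Helper for stub `stub_convexity` of line `Sketch` of crux `PeriodicGivenLayered`
(stmt-AtomisticToContinuum-11779). The block energy of `n + 1` layers with increments `Δ` is
`F(Δ) = ∑_{i<n} ∑_{j ∈ (i,n]} ψ (j-i) (∑_{l ∈ [i,j)} Δ l)` for a family of pair functions `ψ k`
(span `k = j - i`). This file proves the purely combinatorial reduction: if the nearest-layer
function `ψ 1` is uniformly midpoint-convex with constant `m` on the box `[L, U]`, and the span-`k`
functions have midpoint defects bounded below by `-s k (h - h')²` on `[kL, kU]` with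
`∑_{2 ≤ k ≤ n} k² s k ≤ S`, then `F` is uniformly midpoint-convex in the increments with constant
`m - S` (Cauchy–Schwarz on each window plus a window-counting argument). [folklore]
-/

namespace Summit.AtomisticToContinuum.Crystallization.Theorems.LayeredHull

open Finset

/-- Reindexing a sum over `(i, n]` by the offset from `i + 1`. [folklore] -/
theorem cvx_sum_Ioc_eq_sum_range (i n : ℕ) (g : ℕ → ℝ) :
    ∑ j ∈ Ioc i n, g j = ∑ k ∈ range (n - i), g (i + 1 + k) := by
  have h : Ioc i n = Ico (i + 1) (n + 1) := by
    ext x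
    simp only [mem_Ioc, mem_Ico]
    omega
  have e : n + 1 - (i + 1) = n - i := by omega
  rw [h, Finset.sum_Ico_eq_sum_range, e]

/-- A shifted partial sum of a nonnegative sequence is at most the full sum:
`∑_{i < n - k} w (i + m) ≤ ∑_{l < n} w l` for `m ≤ k`. [folklore] -/
theorem cvx_sum_shift_le (n k m : ℕ) (hm : m ≤ k) (w : ℕ → ℝ) (hw : ∀ l, 0 ≤ w l) :
    ∑ i ∈ range (n - k), w (i + m) ≤ ∑ l ∈ range n, w l := by
  have hinj : Set.InjOn (fun i : ℕ => i + m) ↑(range (n - k)) := fun a _ b _ h => by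
    simpa using h
  rw [← Finset.sum_image (f := w) hinj]
  apply Finset.sum_le_sum_of_subset_of_nonneg
  · intro x hx
    simp only [mem_image, mem_range] at hx ⊢
    obtain ⟨i, hi, rfl⟩ := hx
    omega
  · intro l _ _
    exact hw l

/-- **Window counting.** For nonnegative weights `t k` (per span) and `w l` (per site),
`∑_{i<n} ∑_{j∈(i,n]} t (j-i) ∑_{l∈[i,j)} w l ≤ (∑_{1 ≤ k ≤ n} k t k) ∑_{l<n} w l`: each site lies in at
most `k` windows of span `k`. [folklore] -/
theorem cvx_window_sum_le (n : ℕ) (t : ℕ → ℝ) (ht : ∀ k, 0 ≤ t k) (w : ℕ → ℝ)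
    (hw : ∀ l, 0 ≤ w l) :
    ∑ i ∈ range n, ∑ j ∈ Ioc i n, t (j - i) * ∑ l ∈ Ico i j, w l ≤
      (∑ k ∈ Icc 1 n, (k : ℝ) * t k) * ∑ l ∈ range n, w l := by
  -- reindex the inner sums by the span offset `k = j - i - 1`
  have h1 : ∀ i ∈ range n, ∑ j ∈ Ioc i n, t (j - i) * ∑ l ∈ Ico i j, w l =
      ∑ k ∈ range (n - i), t (k + 1) * ∑ l' ∈ range (k + 1), w (i + l') := by
    intro i _
    rw [cvx_sum_Ioc_eq_sum_range]
    refine Finset.sum_congr rfl fun k _ => ?_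
    have e1 : i + 1 + k - i = k + 1 := by omega
    rw [e1, Finset.sum_Ico_eq_sum_range]
    have e2 : i + 1 + k - i = k + 1 := by omega
    rw [e2]
  rw [Finset.sum_congr rfl h1]
  -- swap the order of summation
  rw [Finset.sum_comm' (s' := fun k => range (n - k)) (t' := range n) (by
    intro i k
    simp only [mem_range]
    omega)]
  -- the span sum on the right, reindexed
  have h2 : ∑ k ∈ Icc 1 n, (k : ℝ) * t k = ∑ k ∈ range n, ((k : ℝ) + 1) * t (k + 1) := by
    have e : Icc 1 n = Ico 1 (n + 1) := by
      ext x
      simp only [mem_Icc, mem_Ico]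
      omega
    rw [e, Finset.sum_Ico_eq_sum_range]
    refine Finset.sum_congr (by congr 1) fun k _ => ?_
    push_cast
    ring
  rw [h2, Finset.sum_mul]
  refine Finset.sum_le_sum fun k hk => ?_
  rw [mem_range] at hk
  -- for a fixed span: `∑_{i < n-k} t (k+1) ∑_{l' ≤ k} w (i + l') ≤ (k+1) t (k+1) ∑ w`
  rw [← Finset.mul_sum, Finset.sum_comm]
  have h3 : ∑ l' ∈ range (k + 1), ∑ i ∈ range (n - k), w (i + l') ≤
      ∑ _l' ∈ range (k + 1), ∑ l ∈ range n, w l :=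
    Finset.sum_le_sum fun l' hl' => cvx_sum_shift_le n k l' (by
      rw [mem_range] at hl'
      omega) w hw
  rw [Finset.sum_const, card_range, nsmul_eq_mul] at h3
  calc t (k + 1) * ∑ l' ∈ range (k + 1), ∑ i ∈ range (n - k), w (i + l')
      ≤ t (k + 1) * ((k + 1 : ℕ) * ∑ l ∈ range n, w l) :=
        mul_le_mul_of_nonneg_left h3 (ht _)
    _ = ((k : ℝ) + 1) * t (k + 1) * ∑ l ∈ range n, w l := by push_cast; ring

/-- **The abstract reduction.** Let `ψ k` (`k ≥ 1`) be pair functions such that `ψ 1` is uniformly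
midpoint-convex with constant `m` on `[L, U]`, and for `k ≥ 2` the midpoint defect of `ψ k` on
`[kL, kU]` is at least `-s k (h - h')²`, with `0 ≤ s k` and `∑_{2 ≤ k ≤ n} k² s k ≤ S` for all `n`.
Then the block energy `F(Δ) = ∑_{i<n} ∑_{j∈(i,n]} ψ (j-i) (∑_{l∈[i,j)} Δ l)` satisfies
`(m - S) ∑ (Δ i - Δ' i)² ≤ F(Δ) + F(Δ') - 2 F((Δ + Δ')/2)` for increments in the box `[L, U]`.
[folklore] -/
theorem cvx_reduction (ψ : ℕ → ℝ → ℝ) (L U m S : ℝ) (s : ℕ → ℝ)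
    (h1 : ∀ h h' : ℝ, L ≤ h → h ≤ U → L ≤ h' → h' ≤ U →
      m * (h - h') ^ 2 ≤ ψ 1 h + ψ 1 h' - 2 * ψ 1 ((h + h') / 2))
    (h2 : ∀ k : ℕ, 2 ≤ k → ∀ h h' : ℝ, (k : ℝ) * L ≤ h → h ≤ k * U → (k : ℝ) * L ≤ h' →
      h' ≤ k * U → -(s k * (h - h') ^ 2) ≤ ψ k h + ψ k h' - 2 * ψ k ((h + h') / 2))
    (hs : ∀ k, 2 ≤ k → 0 ≤ s k)
    (hS : ∀ n : ℕ, ∑ k ∈ Finset.Icc 2 n, (k : ℝ) ^ 2 * s k ≤ S)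
    (n : ℕ) (Δ Δ' : ℕ → ℝ)
    (hΔ : ∀ i, i < n → L ≤ Δ i ∧ Δ i ≤ U) (hΔ' : ∀ i, i < n → L ≤ Δ' i ∧ Δ' i ≤ U) :
    (m - S) * ∑ i ∈ Finset.range n, (Δ i - Δ' i) ^ 2 ≤
      (∑ i ∈ Finset.range n, ∑ j ∈ Finset.Ioc i n, ψ (j - i) (∑ l ∈ Finset.Ico i j, Δ l)) +
      (∑ i ∈ Finset.range n, ∑ j ∈ Finset.Ioc i n, ψ (j - i) (∑ l ∈ Finset.Ico i j, Δ' l)) -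
      2 * (∑ i ∈ Finset.range n, ∑ j ∈ Finset.Ioc i n,
        ψ (j - i) (∑ l ∈ Finset.Ico i j, (Δ l + Δ' l) / 2)) := by
  -- per-span weights: `t 1 = 0`, `t k = k s k` for `k ≥ 2`
  set t : ℕ → ℝ := fun k => if k = 1 then 0 else (k : ℝ) * s k with ht_def
  have ht0 : ∀ k, 1 ≤ k → 0 ≤ t k := by
    intro k hk
    simp only [ht_def]
    split_ifs with h
    · exact le_refl _
    · exact mul_nonneg (Nat.cast_nonneg _) (hs k (by omega))
  have ht0' : ∀ k, 0 ≤ t k := by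
    intro k
    simp only [ht_def]
    split_ifs with h
    · exact le_refl _
    · rcases Nat.eq_zero_or_pos k with hk | hk
      · simp [hk]
      · exact mul_nonneg (Nat.cast_nonneg _) (hs k (by omega))
  set y : ℕ → ℝ := fun l => Δ l - Δ' l with hy_def
  -- the termwise lower bound
  have key : ∀ i ∈ range n, ∀ j ∈ Ioc i n,
      (if j = i + 1 then m * y i ^ 2 else 0) - t (j - i) * ∑ l ∈ Ico i j, y l ^ 2 ≤
        ψ (j - i) (∑ l ∈ Ico i j, Δ l) + ψ (j - i) (∑ l ∈ Ico i j, Δ' l) -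
          2 * ψ (j - i) (∑ l ∈ Ico i j, (Δ l + Δ' l) / 2) := by
    intro i hi j hj
    rw [mem_range] at hi
    rw [mem_Ioc] at hj
    have hmid : ∑ l ∈ Ico i j, (Δ l + Δ' l) / 2 =
        (∑ l ∈ Ico i j, Δ l + ∑ l ∈ Ico i j, Δ' l) / 2 := by
      rw [← Finset.sum_add_distrib, ← Finset.sum_div]
    have hlo : ∀ g : ℕ → ℝ, (∀ l, l < n → L ≤ g l ∧ g l ≤ U) →
        ((j - i : ℕ) : ℝ) * L ≤ ∑ l ∈ Ico i j, g l ∧ ∑ l ∈ Ico i j, g l ≤ ((j - i : ℕ) : ℝ) * U := by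
      intro g hg
      constructor
      · have : ∑ _l ∈ Ico i j, L ≤ ∑ l ∈ Ico i j, g l :=
          Finset.sum_le_sum fun l hl => (hg l (by rw [mem_Ico] at hl; omega)).1
        rwa [Finset.sum_const, Nat.card_Ico, nsmul_eq_mul] at this
      · have : ∑ l ∈ Ico i j, g l ≤ ∑ _l ∈ Ico i j, U :=
          Finset.sum_le_sum fun l hl => (hg l (by rw [mem_Ico] at hl; omega)).2
        rwa [Finset.sum_const, Nat.card_Ico, nsmul_eq_mul] at this
    obtain ⟨hΔlo, hΔhi⟩ := hlo Δ hΔ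
    obtain ⟨hΔ'lo, hΔ'hi⟩ := hlo Δ' hΔ'
    rw [hmid]
    by_cases hji : j = i + 1
    · -- nearest layers: span 1
      subst hji
      have e1 : i + 1 - i = 1 := by omega
      simp only [if_true, e1, Nat.Ico_succ_singleton, Finset.sum_singleton, ht_def,
        zero_mul, sub_zero]
      simp only [e1, Nat.Ico_succ_singleton, Finset.sum_singleton, Nat.cast_one,
        one_mul] at hΔlo hΔhi hΔ'lo hΔ'hi
      exact h1 (Δ i) (Δ' i) hΔlo hΔhi hΔ'lo hΔ'hi
    · -- span `k ≥ 2`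
      have hk : 2 ≤ j - i := by omega
      simp only [hji, if_false, zero_sub]
      have hcs : (∑ l ∈ Ico i j, y l) ^ 2 ≤ ((j - i : ℕ) : ℝ) * ∑ l ∈ Ico i j, y l ^ 2 := by
        have := sq_sum_le_card_mul_sum_sq (s := Ico i j) (f := y)
        rwa [Nat.card_Ico] at this
      have hsum_y : ∑ l ∈ Ico i j, y l = ∑ l ∈ Ico i j, Δ l - ∑ l ∈ Ico i j, Δ' l := by
        simp only [hy_def, Finset.sum_sub_distrib]
      have hdef := h2 (j - i) hk (∑ l ∈ Ico i j, Δ l) (∑ l ∈ Ico i j, Δ' l) hΔlo hΔhi hΔ'lo hΔ'hi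
      have htk : t (j - i) = ((j - i : ℕ) : ℝ) * s (j - i) := by
        simp only [ht_def]
        rw [if_neg (by omega)]
      rw [htk]
      have hs0 : 0 ≤ s (j - i) := hs _ hk
      calc -(((j - i : ℕ) : ℝ) * s (j - i) * ∑ l ∈ Ico i j, y l ^ 2)
          = -(s (j - i) * (((j - i : ℕ) : ℝ) * ∑ l ∈ Ico i j, y l ^ 2)) := by ring
        _ ≤ -(s (j - i) * (∑ l ∈ Ico i j, y l) ^ 2) := by
            apply neg_le_neg
            exact mul_le_mul_of_nonneg_left hcs hs0
        _ = -(s (j - i) * (∑ l ∈ Ico i j, Δ l - ∑ l ∈ Ico i j, Δ' l) ^ 2) := by rw [hsum_y]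
        _ ≤ _ := hdef
  -- sum the termwise bounds
  have hsum := Finset.sum_le_sum fun i hi => Finset.sum_le_sum fun j hj => key i hi j hj
  -- the right-hand side is the defect
  have hR : ∑ i ∈ range n, ∑ j ∈ Ioc i n,
      (ψ (j - i) (∑ l ∈ Ico i j, Δ l) + ψ (j - i) (∑ l ∈ Ico i j, Δ' l) -
        2 * ψ (j - i) (∑ l ∈ Ico i j, (Δ l + Δ' l) / 2)) =
      (∑ i ∈ range n, ∑ j ∈ Ioc i n, ψ (j - i) (∑ l ∈ Ico i j, Δ l)) +
      (∑ i ∈ range n, ∑ j ∈ Ioc i n, ψ (j - i) (∑ l ∈ Ico i j, Δ' l)) -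
      2 * (∑ i ∈ range n, ∑ j ∈ Ioc i n, ψ (j - i) (∑ l ∈ Ico i j, (Δ l + Δ' l) / 2)) := by
    simp only [Finset.sum_sub_distrib, Finset.sum_add_distrib, Finset.mul_sum]
  -- the left-hand side splits into the diagonal part and the window part
  have hL : ∑ i ∈ range n, ∑ j ∈ Ioc i n,
      ((if j = i + 1 then m * y i ^ 2 else 0) - t (j - i) * ∑ l ∈ Ico i j, y l ^ 2) =
      m * ∑ i ∈ range n, y i ^ 2 -
        ∑ i ∈ range n, ∑ j ∈ Ioc i n, t (j - i) * ∑ l ∈ Ico i j, y l ^ 2 := by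
    simp only [Finset.sum_sub_distrib, Finset.mul_sum]
    congr 1
    refine Finset.sum_congr rfl fun i hi => ?_
    rw [mem_range] at hi
    rw [Finset.sum_ite_eq']
    rw [if_pos (by rw [mem_Ioc]; omega)]
  rw [hR] at hsum
  rw [hL] at hsum
  -- the window part is at most `S ∑ y²`
  have hwin := cvx_window_sum_le n t ht0' (fun l => y l ^ 2) (fun l => sq_nonneg _)
  have hspan : ∑ k ∈ Icc 1 n, (k : ℝ) * t k = ∑ k ∈ Icc 2 n, (k : ℝ) ^ 2 * s k := by
    rcases Nat.eq_zero_or_pos n with hn | hn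
    · subst hn
      simp
    · rw [← Finset.insert_Icc_add_one_left_eq_Icc hn, Finset.sum_insert (by simp)]
      simp only [ht_def, if_true, mul_zero, zero_add]
      refine Finset.sum_congr rfl fun k hk => ?_
      rw [mem_Icc] at hk
      rw [if_neg (by omega)]
      ring
  rw [hspan] at hwin
  have hy2 : 0 ≤ ∑ l ∈ range n, y l ^ 2 := Finset.sum_nonneg fun l _ => sq_nonneg _
  have hwin' : ∑ i ∈ range n, ∑ j ∈ Ioc i n, t (j - i) * ∑ l ∈ Ico i j, y l ^ 2 ≤
      S * ∑ l ∈ range n, y l ^ 2 :=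
    hwin.trans (mul_le_mul_of_nonneg_right (hS n) hy2)
  calc (m - S) * ∑ i ∈ range n, (Δ i - Δ' i) ^ 2
      = m * ∑ i ∈ range n, y i ^ 2 - S * ∑ l ∈ range n, y l ^ 2 := by
        simp only [hy_def]; ring
    _ ≤ m * ∑ i ∈ range n, y i ^ 2 -
        ∑ i ∈ range n, ∑ j ∈ Ioc i n, t (j - i) * ∑ l ∈ Ico i j, y l ^ 2 := by linarith
    _ ≤ _ := hsum

end Summit.AtomisticToContinuum.Crystallization.Theorems.LayeredHull
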